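import Mathlib
import HarnessLib
import Literature.MathematicalPhysics.KineticTheory.HardSphereEulerProofs
import Literature.MathematicalPhysics.KineticTheory.HardSphereTwoTimePressure
import Summits.AtomisticToContinuum.HydrodynamicLimit.Theses.OneFlightGossipEngine
import Summits.AtomisticToContinuum.HydrodynamicLimit.Theorems.OneFlightGossipEngineKineticCurrentsWindowLDApriori
import Summits.AtomisticToContinuum.HydrodynamicLimit.Theorems.OneFlightGossipEngineKineticCurrentsLDAlongFamiliesWindowRenyiOfTransport
import Summits.AtomisticToContinuum.HydrodynamicLimit.Theorems.OneFlightGossipEngineKineticCurrentsWindowLDUniformWindowRenyiOfTransportPrelim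

/-! # Window-averaged kinetic energy: exponential moments along a profile family
— stub `stub_windowEnergyExpMoment` of line `Sketch`, crux `LocalClampedTransferLDAlongFamilies`
(stmt-AtomisticToContinuum-17691)

For `N+1` hard spheres of diameter `σ(N+1)^{-1/3}` on `𝕋³`, a hard-sphere flow `Φ N` and the local
Gibbs reference laws `λ^N_s = localGibbsLaw σ (a s) (u₀ s) (θ₀ s) N (Φ N)` of a jointly continuous
positive profile family on `[0,t₁] × 𝕋³`, we prove: for every `κ > 0` there is `γ > 0` (depending
only on `κ` and on the bounds `sup θ₀`, `sup ‖u₀‖` over `[0,t₁] × 𝕋³`) such that for EVERY flow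
family, window multiplier `τ > 0`, `N` and `s ∈ [0,t₁]`,
`∫ exp(γ ∑ᵢ w⁻¹∫₀ʷ ‖vᵢ(r)‖² dr) dλ^N_s ≤ exp(κ(N+1))`, `w = τ(N+1)^{-1/3}`.

Outline: (i) along a good orbit the kinetic energy is conserved, so the window average of
`∑ᵢ ‖vᵢ(r)‖²` is `2E(z)` (`sum_window_integral_norm_sq_eq`), and `λ^N_s`-a.e. configuration is good;
(ii) conditionally on the positions the velocities are independent Gaussians, whence
`∫ e^{γ'E} dλ^N ≤ (e^{γ'U²}(1-2γ'Θ)^{-3/2})^{N+1}` (`lintegral_exp_mul_configEnergy_localGibbsLaw_le`);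
(iii) the family is bounded on the compact `[0,t₁] × 𝕋³` (`wrf_exists_forall_le_family`) and
`γ'` is chosen by `wre_exists_gamma` so that the one-particle constant is `≤ e^κ`; `γ = γ'/2`.

References: Olla–Varadhan–Yau, Comm. Math. Phys. 155 (1993) 523, §2–3; Spohn, *Large Scale
Dynamics of Interacting Particles* (1991), Part I §2.3.
-/

noncomputable section

open MeasureTheory Set Filter
open scoped ENNReal Topology BigOperators

namespace Summit.AtomisticToContinuum.HydrodynamicLimit.Theorems.LocalClampedTransferSketch

open Literature.Analysis.FluidPDE (HardSphereFlow Config localMaxwellian canonicalDensity liouville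
  hardSphereDomain configEnergy)
open Literature.MathematicalPhysics.KineticTheory (T3 V3 hsDiameter localGibbsLaw localGibbsMeasure
  localGibbsProfile rhoLim profileOf hsCompressibility)
open Literature.Analysis.FluidPDE Literature.MathematicalPhysics.KineticTheory
  Literature.Analysis.FunctionSpaces

/-- **Window average of the squared speeds along a good orbit.** For `z` in the good set of a
hard-sphere flow on `𝕋³` and a window `w ≠ 0`,
`∑ᵢ w⁻¹ ∫₀ʷ ‖vᵢ(r)‖² dr = 2 E(z)` (energy conservation along the orbit). -/
theorem wem_sum_window_avg_norm_sq_eq {ε : ℝ} {n : ℕ}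
    (Φ : HardSphereFlow (Torus.geometry (Fin 3)) ε n) {z : Config n (Fin 3) T3}
    (hz : z ∈ Φ.good) {w : ℝ} (hw : w ≠ 0) :
    ∑ i, w⁻¹ * ∫ r in (0 : ℝ)..w, ‖(Φ.flow r z i).2‖ ^ 2 = 2 * configEnergy z := by
  rw [← Finset.mul_sum, (sum_window_integral_norm_sq_eq Φ hz w).2]
  field_simp

/-- **One law, one window.** Under a local Gibbs law with `θ₀ ≤ Θ`, `‖u₀‖ ≤ U`, `σ ≤ 1/2`, if
`0 ≤ γ`, `2γΘ < 1` and `e^{γU²}(1-2γΘ)^{-3/2} ≤ e^κ`, then for every window `w ≠ 0`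
`∫ exp(γ/2 · ∑ᵢ w⁻¹∫₀ʷ ‖vᵢ(r)‖² dr) dλ^N ≤ exp(κ(N+1))`. -/
theorem wem_lintegral_exp_window_energy_le {a₀ θ₀ : T3 → ℝ} {u₀ : T3 → V3}
    (ha : Continuous a₀) (hθ : Continuous θ₀) (hu : Continuous u₀) (ha0 : ∀ x, 0 < a₀ x)
    (hθ0 : ∀ x, 0 < θ₀ x) {σ : ℝ} (hσ2 : σ ≤ 1 / 2) (N : ℕ)
    (Φ : HardSphereFlow (Torus.geometry (Fin 3)) (hsDiameter σ N) (N + 1))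
    {γ Θ U κ : ℝ} (hγ : 0 ≤ γ) (hΘ : ∀ x, θ₀ x ≤ Θ) (hU : ∀ x, ‖u₀ x‖ ≤ U)
    (hγΘ : 2 * γ * Θ < 1)
    (hK : Real.exp (γ * U ^ 2) * (1 - 2 * γ * Θ) ^ (-(3 : ℝ) / 2) ≤ Real.exp κ)
    {w : ℝ} (hw : w ≠ 0) :
    ∫⁻ z, ENNReal.ofReal (Real.exp (γ / 2 * ∑ i : Fin (N + 1),
        w⁻¹ * ∫ r in (0 : ℝ)..w, ‖((Φ.flow r z) i).2‖ ^ 2)) ∂(localGibbsLaw σ a₀ u₀ θ₀ N Φ) ≤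
      ENNReal.ofReal (Real.exp (κ * ((N : ℝ) + 1))) := by
  have hae : ∀ᵐ z ∂(localGibbsLaw σ a₀ u₀ θ₀ N Φ),
      ENNReal.ofReal (Real.exp (γ / 2 * ∑ i : Fin (N + 1),
          w⁻¹ * ∫ r in (0 : ℝ)..w, ‖((Φ.flow r z) i).2‖ ^ 2)) =
        ENNReal.ofReal (Real.exp (γ * configEnergy z)) := by
    filter_upwards [ae_mem_good_localGibbsLaw σ a₀ u₀ θ₀ N Φ] with z hz
    rw [wem_sum_window_avg_norm_sq_eq Φ hz hw]
    ring_nf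
  rw [lintegral_congr_ae hae]
  refine (lintegral_exp_mul_configEnergy_localGibbsLaw_le ha hθ hu ha0 hθ0 hσ2 N Φ hγ hΘ hU
    hγΘ).trans (ENNReal.ofReal_le_ofReal ?_)
  have hK0 : 0 ≤ Real.exp (γ * U ^ 2) * (1 - 2 * γ * Θ) ^ (-(3 : ℝ) / 2) :=
    mul_nonneg (Real.exp_nonneg _) (Real.rpow_nonneg (by linarith) _)
  calc (Real.exp (γ * U ^ 2) * (1 - 2 * γ * Θ) ^ (-(3 : ℝ) / 2)) ^ (N + 1)
      ≤ Real.exp κ ^ (N + 1) := pow_le_pow_left₀ hK0 hK _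
    _ = Real.exp (κ * ((N : ℝ) + 1)) := by
        rw [← Real.exp_nat_mul]
        push_cast
        ring_nf

/-- The kinetic window `w_N = τ(N+1)^{-1/3}` is nonzero for `τ > 0`. -/
theorem wem_window_ne_zero {τ : ℝ} (hτ : 0 < τ) (N : ℕ) :
    τ * ((N : ℝ) + 1) ^ (-(1 / 3 : ℝ)) ≠ 0 :=
  (mul_pos hτ (Real.rpow_pos_of_pos (by positivity) _)).ne'

/-- **Exponential moments of the window-averaged kinetic energy along a profile family
(stub `stub_windowEnergyExpMoment`, S3 of line `Sketch`).** For a jointly continuous positive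
profile family on `[0,t₁] × 𝕋³`, `0 < σ ≤ 1/2` and `κ > 0` there is `γ > 0` such that for every
hard-sphere flow family, every `τ > 0`, every `N` and every `s ∈ [0,t₁]`,
`∫ exp(γ ∑ᵢ w⁻¹∫₀ʷ ‖vᵢ(r)‖² dr) dλ^N_s ≤ exp(κ(N+1))` with `w = τ(N+1)^{-1/3}`: energy
conservation on good orbits reduces the window functional to `2γE(z)`, and the Gaussian velocity
fibres of `λ^N_s` (temperatures `≤ sup θ₀`, drifts `≤ sup ‖u₀‖` on `[0,t₁] × 𝕋³`) give a
one-particle constant `≤ e^κ` for `γ` small. -/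
theorem stub_windowEnergyExpMoment :
    ∀ (t₁ : ℝ) (a θ₀ : ℝ → T3 → ℝ) (u₀ : ℝ → T3 → V3),
      Continuous (Function.uncurry a) → Continuous (Function.uncurry θ₀) →
      Continuous (Function.uncurry u₀) → (∀ s x, 0 < a s x) → (∀ s x, 0 < θ₀ s x) →
      ∀ σ : ℝ, 0 < σ → σ ≤ 1 / 2 → ∀ κ : ℝ, 0 < κ → ∃ γ : ℝ, 0 < γ ∧
      ∀ Φ : (N : ℕ) → HardSphereFlow (Torus.geometry (Fin 3)) (hsDiameter σ N) (N + 1),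
      ∀ τ : ℝ, 0 < τ → ∀ N : ℕ, ∀ s ∈ Set.Icc 0 t₁,
        ∫⁻ z, ENNReal.ofReal (Real.exp (γ * ∑ i : Fin (N + 1),
            (τ * ((N : ℝ) + 1) ^ (-(1 / 3 : ℝ)))⁻¹ *
              ∫ r in (0 : ℝ)..(τ * ((N : ℝ) + 1) ^ (-(1 / 3 : ℝ))), ‖(((Φ N).flow r z) i).2‖ ^ 2))
          ∂(localGibbsLaw σ (a s) (u₀ s) (θ₀ s) N (Φ N)) ≤
        ENNReal.ofReal (Real.exp (κ * ((N : ℝ) + 1))) := by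
  intro t₁ a θ₀ u₀ ha hθ hu ha0 hθ0 σ _hσ hσ2 κ hκ
  obtain ⟨Θ, hΘ0, hΘ⟩ := KineticCurrentsLDAlongFamiliesSketch.wrf_exists_forall_le_family hθ t₁
  obtain ⟨U, -, hU⟩ := KineticCurrentsLDAlongFamiliesSketch.wrf_exists_forall_le_family
    (f := fun s x => ‖u₀ s x‖) (by fun_prop) t₁
  obtain ⟨γ, hγ0, hγΘ, hγK⟩ := KineticCurrentsWindowLDUniformLocalGibbs.wre_exists_gamma hΘ0 hκ U
  refine ⟨γ / 2, half_pos hγ0, fun Φ τ hτ N s hs => ?_⟩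
  exact wem_lintegral_exp_window_energy_le (ha.uncurry_left s) (hθ.uncurry_left s)
    (hu.uncurry_left s) (ha0 s) (hθ0 s) hσ2 N (Φ N) hγ0.le (hΘ s hs) (hU s hs) hγΘ hγK
    (wem_window_ne_zero hτ N)

end Summit.AtomisticToContinuum.HydrodynamicLimit.Theorems.LocalClampedTransferSketch

end
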